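/-
Copyright (c) 2026 H21 harness. All rights reserved.
Released under Apache 2.0 license as described in the file LICENSE.
-/
import Mathlib
import Summits.ResolutionOfSingularities.ResolutionOfSingularities.Theorems.FrobeniusClosingSteerDerivationNilpotent
import Summits.ResolutionOfSingularities.ResolutionOfSingularities.Theorems.FrobeniusClosingSteerSwitchingAssembly
import Summits.ResolutionOfSingularities.ResolutionOfSingularities.Theorems.FrobeniusClosingSteerShannonCoarseningLemmas

/-!
# Frobenius-closing steer — derivation criterion: the constants of `D` are the fractions of `A₀`

Context: Steer crux `stmt-ResolutionOfSingularities-16345`, card `singular-trace-constructor`, DERIVATION CRITERION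
(`FrobeniusClosingSteerDerivationExit` / `…Nilpotent` / `…NoExit`).  Those files describe the ring of constants object-free, as
`{x ∈ S | D x = 0}`; the card (and `SingularTrace.TraceNotRegular`) speaks of the TRACE `S ∩ Frac A₀` (`IsFracOf A₀`).  This file
identifies the two:

* `apply_eq_zero_iff_isFracOf` — for `K = Frac (k[A₀, t])` of characteristic `p` with `t ^ p ∈ A₀`, and a `k`-derivation `D` of `K`
  with `D(A₀) = 0` and `D ≠ 0` (`D y ≠ 0` for some `y`):  `D x = 0 ↔ IsFracOf A₀ x`.  Hence `S ∩ ker D = S ∩ Frac A₀` for every `S`.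
* `not_isUnit_apply_of_noExitModel_trace` — the contrapositive of the derivation criterion under `SingularTrace.NoExitModel'`
  (`FrobeniusClosingSteerDerivationNoExit`) with the trace clause in the form used by `SingularTrace.TraceNotRegular`
  (`x ∈ locAtCentre A'' O ↔ x ∈ locAtCentre A O ∧ IsFracOf A₀ x`): on a model `A ∋ t` regular at the centre whose trace on `Frac A₀`
  is the centre ring of a finitely generated `A'' ⊇ A₀`, every `k`-derivation `D` with `D(S) ⊆ S`, `D(A₀) = 0` maps non-units of
  `S = locAtCentre A O` to non-units.

Ingredients: `apply_eq_zero_of_mem_closure` (a derivation killing `A₀` kills the subfield `F₀` it generates);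
`Shannon.pow_mem_of_mem_adjoin_insert` (`b ∈ k[A₀, t] ⇒ b ^ p ∈ A₀`, Frobenius); `exists_sum_range_eq` (every `x ∈ K` is `∑_{j<p} g_j t^j` with
`g_j ∈ F₀`: write `x = (a b^{p-1}) / b^p` and reduce exponents of `t` modulo `p`); the degree count `minpoly F₀ t = X ^ p − C (t ^ p)`
(`X_pow_sub_C_irreducible_of_prime`, as `t ∉ F₀` because `D y ≠ 0`) and Mathlib's `linearIndependent_pow`; finally
`t · D x = D t · ∑ j g_j t^j`, so `D x = 0` forces `j g_j = 0`, i.e. `x = g_0 ∈ F₀`.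
-/

open Polynomial
open Summit.ResolutionOfSingularities.ResolutionOfSingularities.Theorems.SwitchingDichotomy.Words

set_option linter.dupNamespace false

namespace Summit.ResolutionOfSingularities.ResolutionOfSingularities.Theorems.SwitchingDichotomy

namespace DerivationExit

variable {k K : Type} [Field k] [Field K] [Algebra k K]

/-- A derivation killing `A₀` kills the subfield generated by `A₀`. [folklore] -/
theorem apply_eq_zero_of_mem_closure (D : Derivation k K K) (A₀ : Subalgebra k K) (hDA : ∀ a ∈ A₀, D a = 0) {x : K}
    (hx : x ∈ Subfield.closure (A₀ : Set K)) : D x = 0 := by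
  induction hx using Subfield.closure_induction with
  | mem x hx => exact hDA x hx
  | one => exact D.map_one_eq_zero
  | add x y _ _ hx hy => rw [map_add, hx, hy, add_zero]
  | neg x _ hx => rw [map_neg, hx, neg_zero]
  | inv x _ hx => rw [Derivation.leibniz_inv, hx, smul_zero]
  | mul x y _ _ hx hy => rw [Derivation.leibniz, hx, hy, smul_zero, smul_zero, add_zero]

/-- **Expansion in powers of `t`**: every `x ∈ K = Frac (k[A₀, t])` is `∑_{j < p} g_j · t ^ j` with `g_j` in the subfield generated by
`A₀` (write `x = a b^{p-1} / b^p`, `b^p ∈ A₀`, and reduce the exponents of `t` modulo `p`). [folklore] -/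
theorem exists_sum_range_eq (p : ℕ) [Fact p.Prime] [CharP K p] (A₀ : Subalgebra k K) (t : K) (htp : t ^ p ∈ A₀)
    [IsFractionRing (Algebra.adjoin k (insert t (A₀ : Set K))) K] (x : K) :
    ∃ g : ℕ → K, (∀ j, g j ∈ Subfield.closure (A₀ : Set K)) ∧ x = ∑ j ∈ Finset.range p, g j * t ^ j := by
  have hp : p.Prime := Fact.out
  obtain ⟨a, b, hb, rfl⟩ := IsFractionRing.div_surjective (A := Algebra.adjoin k (insert t (A₀ : Set K))) x
  have hb0 : (b : K) ≠ 0 := by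
    have : (b : Algebra.adjoin k (insert t (A₀ : Set K))) ≠ 0 := nonZeroDivisors.ne_zero hb
    exact fun h => this (Subtype.ext h)
  have hbp : (b : K) ^ p ∈ A₀ := Shannon.pow_mem_of_mem_adjoin_insert p A₀ htp b.2
  have hab : (a : K) * (b : K) ^ (p - 1) ∈ Algebra.adjoin k (insert t (A₀ : Set K)) :=
    Subalgebra.mul_mem _ a.2 (Subalgebra.pow_mem _ b.2 _)
  obtain ⟨q, hq, hqt⟩ := SingularTrace.exists_polynomial_of_mem_adjoin A₀ t hab
  have hx : algebraMap _ K a / algebraMap _ K b = ((b : K) ^ p)⁻¹ * q.eval t := by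
    change (a : K) / (b : K) = _
    rw [hqt, SingularTrace.pow_eq_pow_pred_mul hp.one_le (b : K)]
    field_simp
  refine ⟨fun j => ((b : K) ^ p)⁻¹ * ∑ i ∈ q.support with i % p = j, q.coeff i * (t ^ p) ^ (i / p), fun j =>
    mul_mem (inv_mem (Subfield.subset_closure hbp)) (sum_mem fun i _ =>
      mul_mem (Subfield.subset_closure (hq i)) (pow_mem (Subfield.subset_closure htp) _)), ?_⟩
  rw [hx, eval_eq_sum, Polynomial.sum_def,
    ← Finset.sum_fiberwise_of_maps_to (s := q.support) (t := Finset.range p) (g := fun i => i % p)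
      (fun i _ => Finset.mem_range.mpr (Nat.mod_lt i hp.pos)), Finset.mul_sum]
  refine Finset.sum_congr rfl fun j _ => ?_
  dsimp only
  rw [Finset.mul_sum, Finset.mul_sum, Finset.sum_mul]
  refine Finset.sum_congr rfl fun i hi => ?_
  have hti : t ^ i = (t ^ p) ^ (i / p) * t ^ (i % p) := by
    rw [← pow_mul, ← pow_add, Nat.div_add_mod]
  rw [← (Finset.mem_filter.mp hi).2, hti]
  ring

/-- **`t ∉ Frac A₀`** as soon as some `k`-derivation killing `A₀` does not vanish identically. [folklore] -/
theorem not_mem_closure_of_apply_ne_zero (p : ℕ) [Fact p.Prime] [CharP K p] (A₀ : Subalgebra k K) (t : K) (htp : t ^ p ∈ A₀)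
    [IsFractionRing (Algebra.adjoin k (insert t (A₀ : Set K))) K] (D : Derivation k K K) (hDA : ∀ a ∈ A₀, D a = 0)
    {y : K} (hy : D y ≠ 0) : t ∉ Subfield.closure (A₀ : Set K) := by
  intro ht
  obtain ⟨g, hg, hyg⟩ := exists_sum_range_eq p A₀ t htp y
  refine hy (apply_eq_zero_of_mem_closure D A₀ hDA ?_)
  rw [hyg]
  exact sum_mem fun j _ => mul_mem (hg j) (pow_mem ht j)

/-- **The minimal polynomial of `t` over `F₀ = Frac A₀` is `X ^ p − t ^ p`** when `t ∉ F₀`. [folklore] -/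
theorem minpoly_eq (p : ℕ) [Fact p.Prime] [CharP K p] (F₀ : Subfield K) (t : K) (htp : t ^ p ∈ F₀) (ht : t ∉ F₀) :
    minpoly F₀ t = X ^ p - C (⟨t ^ p, htp⟩ : F₀) := by
  have hp : p.Prime := Fact.out
  symm
  refine minpoly.eq_of_irreducible_of_monic (X_pow_sub_C_irreducible_of_prime hp fun b hb => ht ?_) ?_
    (monic_X_pow_sub_C _ hp.ne_zero)
  · have hbt : ((b : K)) ^ p = t ^ p := by
      have := congrArg Subtype.val hb
      simpa using this
    have : (b : K) = t := frobenius_inj K p hbt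
    exact this ▸ b.2
  · simp only [map_sub, map_pow, aeval_X, aeval_C]
    exact sub_eq_zero.mpr rfl

/-- **Linear independence of `1, t, …, t^{p-1}` over `F₀ = Frac A₀`** (from `minpoly_eq`), in coordinates: a vanishing combination
`∑_{j<p} c_j t^j = 0` with `c_j ∈ F₀` has all `c_j = 0`. [folklore] -/
theorem eq_zero_of_sum_range_eq_zero (p : ℕ) [Fact p.Prime] [CharP K p] (F₀ : Subfield K) (t : K) (htp : t ^ p ∈ F₀)
    (ht : t ∉ F₀) (c : ℕ → K) (hc : ∀ j, c j ∈ F₀) (h0 : ∑ j ∈ Finset.range p, c j * t ^ j = 0) :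
    ∀ j < p, c j = 0 := by
  have hdeg : (minpoly F₀ t).natDegree = p := by
    rw [minpoly_eq p F₀ t htp ht, natDegree_X_pow_sub_C]
  have hli := linearIndependent_pow (K := F₀) t
  rw [hdeg] at hli
  intro j hj
  have key := Fintype.linearIndependent_iff.mp hli (fun i => ⟨c i, hc i⟩) ?_ ⟨j, hj⟩
  · exact congrArg Subtype.val key
  · rw [← h0, ← Fin.sum_univ_eq_sum_range (fun i => c i * t ^ i) p]
    refine Finset.sum_congr rfl fun i _ => ?_
    rw [Algebra.smul_def]
    rfl

/-- **The constants of `D` are the fractions of `A₀`.**  For `K = Frac (k[A₀, t])` of characteristic `p` with `t ^ p ∈ A₀` and a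
`k`-derivation `D` of `K` with `D(A₀) = 0` and `D y ≠ 0` for some `y`:  `D x = 0 ↔ IsFracOf A₀ x`. [folklore] -/
theorem apply_eq_zero_iff_isFracOf (p : ℕ) [Fact p.Prime] [CharP K p] (A₀ : Subalgebra k K) (t : K) (htp : t ^ p ∈ A₀)
    [IsFractionRing (Algebra.adjoin k (insert t (A₀ : Set K))) K] (D : Derivation k K K) (hDA : ∀ a ∈ A₀, D a = 0)
    {y : K} (hy0 : D y ≠ 0) (x : K) : D x = 0 ↔ IsFracOf A₀ x := by
  have hp : p.Prime := Fact.out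
  constructor
  · intro hDx
    have ht : t ∉ Subfield.closure (A₀ : Set K) := not_mem_closure_of_apply_ne_zero p A₀ t htp D hDA hy0
    -- `D t ≠ 0` (else `D y = c_y · D t = 0`)
    have hDt : D t ≠ 0 := by
      intro hDt
      obtain ⟨cy, hcy⟩ := exists_factor A₀ t y
      have h : D y = cy * D t := hcy (D : K →ₗ[k] K) (fun a b => by
        rw [Derivation.coeFn_coe, Derivation.leibniz, smul_eq_mul, smul_eq_mul])
        (fun a ha => by rw [Derivation.coeFn_coe, hDA a ha])
      rw [hDt, mul_zero] at h
      exact hy0 h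
    obtain ⟨g, hg, hxg⟩ := exists_sum_range_eq p A₀ t htp x
    -- `t · D x = D t · ∑ j, (j g_j) t^j`
    have hsum : t * D x = D t * ∑ j ∈ Finset.range p, ((j : K) * g j) * t ^ j := by
      rw [hxg, map_sum, Finset.mul_sum, Finset.mul_sum]
      refine Finset.sum_congr rfl fun j _ => ?_
      rw [Derivation.leibniz, apply_eq_zero_of_mem_closure D A₀ hDA (hg j), smul_zero, add_zero, Derivation.leibniz_pow,
        smul_eq_mul, nsmul_eq_mul, smul_eq_mul]
      rcases Nat.eq_zero_or_pos j with rfl | hj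
      · simp
      · obtain ⟨i, rfl⟩ : ∃ i, j = i + 1 := ⟨j - 1, (Nat.sub_add_cancel hj).symm⟩
        rw [Nat.add_sub_cancel, pow_succ]
        ring
    rw [hDx, mul_zero] at hsum
    have h0 : ∑ j ∈ Finset.range p, ((j : K) * g j) * t ^ j = 0 := by
      rcases mul_eq_zero.mp hsum.symm with h | h
      · exact absurd h hDt
      · exact h
    have hcoef := eq_zero_of_sum_range_eq_zero p (Subfield.closure (A₀ : Set K)) t (Subfield.subset_closure htp) ht
      (fun j => (j : K) * g j) (fun j => mul_mem (natCast_mem _ j) (hg j)) h0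
    -- all `g j`, `0 < j < p`, vanish
    have hg0 : ∀ j ∈ Finset.range p, j ≠ 0 → g j * t ^ j = 0 := by
      intro j hj hj0
      rw [Finset.mem_range] at hj
      have hjK : (j : K) ≠ 0 := by
        rw [Ne, CharP.cast_eq_zero_iff K p]
        exact fun hdvd => hj0 (Nat.eq_zero_of_dvd_of_lt hdvd hj)
      rcases mul_eq_zero.mp (hcoef j hj) with h | h
      · exact absurd h hjK
      · rw [h, zero_mul]
    have hx0 : x = g 0 := by
      rw [hxg, Finset.sum_eq_single_of_mem 0 (Finset.mem_range.mpr hp.pos) fun j hj hj0 => hg0 j hj hj0, pow_zero, mul_one]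
    rw [hx0]
    exact (exists_div_iff_mem_closure A₀ (g 0)).mpr (hg 0)
  · intro hx
    exact apply_eq_zero_of_mem_closure D A₀ hDA ((exists_div_iff_mem_closure A₀ x).mp hx)

open IsLocalRing Literature.AlgebraicGeometry.Resolution
  Summit.ResolutionOfSingularities.ResolutionOfSingularities.Theorems.SteerRankThinness in
/-- **The derivation criterion, contrapositive under `NoExitModel'`, trace form.**  Under a core datum and `NoExitModel'`, on a model
`A ∋ t` regular at the centre of `O` whose trace `locAtCentre A O ∩ Frac A₀` is the centre ring of a finitely generated `A'' ⊇ A₀`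
inside `O` (the clause of `SingularTrace.TraceNotRegular`), every `k`-derivation `D` of `K` with `D(S) ⊆ S` (`S = locAtCentre A O`)
and `D(A₀) = 0` sends non-units of `S` to non-units of `S` (`D(𝔪_S) ⊆ 𝔪_S`). [folklore] -/
theorem not_isUnit_apply_of_noExitModel_trace (p : ℕ) (hp : p.Prime)
    (n : ℕ) (k K : Type) [Field k] [CharP k p] [Field K] [Algebra k K]
    (O : ValuationSubring K) (A₀ : Subalgebra k K) (h₀ : A₀.toSubring ≤ O.toSubring) (t : K)
    (core : CoreDatum p n k K O A₀ h₀ t) (hNE : SingularTrace.NoExitModel' p O A₀ t)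
    (A : Subalgebra k K) (h : A.toSubring ≤ O.toSubring) (htA : t ∈ A)
    (hregA : IsRegularLocalRing (Localization.AtPrime (Ideal.comap (Subring.inclusion h) (maximalIdeal O))))
    (D : Derivation k K K) (hDS : ∀ s ∈ locAtCentre A.toSubring O, D s ∈ locAtCentre A.toSubring O)
    (hDA : ∀ a ∈ A₀, D a = 0)
    (A'' : Subalgebra k K) (h'' : A''.toSubring ≤ O.toSubring) (hA₀A'' : A₀ ≤ A'') (hfgA'' : A''.FG)
    (htrace : ∀ x : K, x ∈ locAtCentre A''.toSubring O ↔ (x ∈ locAtCentre A.toSubring O ∧ IsFracOf A₀ x))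
    {y : K} (hyS : y ∈ locAtCentre A.toSubring O) (hyu : ¬ IsUnit (⟨y, hyS⟩ : locAtCentre A.toSubring O)) :
    ¬ IsUnit (⟨D y, hDS y hyS⟩ : locAtCentre A.toSubring O) := by
  classical
  haveI : Fact p.Prime := ⟨hp⟩
  haveI : CharP K p := charP_of_injective_algebraMap (algebraMap k K).injective p
  obtain ⟨-, htp, hfr, -⟩ := id core
  haveI instS : IsLocalRing (locAtCentre A.toSubring O) := isLocalRing_locAtCentre h
  haveI instR : IsLocalRing (locAtCentre A''.toSubring O) := isLocalRing_locAtCentre h''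
  haveI hregS : IsRegularLocalRing (locAtCentre A.toSubring O) := (isRegularLocalRing_locAtCentre_iff h).mpr hregA
  intro hu
  have hy0 : D y ≠ 0 := fun h0 => hu.ne_zero (Subtype.ext h0)
  have htrace' : ∀ x : K, x ∈ locAtCentre A''.toSubring O ↔ (x ∈ locAtCentre A.toSubring O ∧ D x = 0) := fun x => by
    rw [htrace x, apply_eq_zero_iff_isFracOf p A₀ t htp D hDA hy0 x]
  have hym : (⟨y, hyS⟩ : locAtCentre A.toSubring O) ∈ maximalIdeal (locAtCentre A.toSubring O) := hyu
  have htS : t ∈ locAtCentre A.toSubring O := le_locAtCentre A.toSubring O htA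
  have hkS : ∀ c : k, algebraMap k K c ∈ locAtCentre A.toSubring O := fun c =>
    le_locAtCentre A.toSubring O (A.algebraMap_mem c)
  have hexit : ExitAt (locAtCentre A''.toSubring O) p t :=
    exitAt_of_derivation_isUnit p A₀ t (locAtCentre A.toSubring O) D hDS hkS hDA hyS hu
      (locAtCentre A''.toSubring O) htrace' hym htS
  have hregR : IsRegularLocalRing (locAtCentre A''.toSubring O) := by
    obtain ⟨s', -, g, -, _, z, hz, -⟩ := hexit
    exact hz.1
  exact hNE A'' h'' hA₀A'' hfgA'' ((isRegularLocalRing_locAtCentre_iff h'').mp hregR) hexit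

end DerivationExit

end Summit.ResolutionOfSingularities.ResolutionOfSingularities.Theorems.SwitchingDichotomy
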